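import Mathlib.CategoryTheory.SingleObj
import Literature.AnabelianGeometry.EtaleTheta.TemperedFrobenioidToyGenuine
import Literature.AnabelianGeometry.EtaleTheta.TemperedFrobenioidToyTorsion

/-!
# [EtTh] Def. 3.6 (ii): a tempered Frobenioid over the GENUINE vocabularies with NON-TRIVIAL units — the torsion datum
# `ToyTorsion` (`B₀ = ℤ × (ℤ/2)²` over `SingleObj ℤ`, swap action) realified (model-construction file)

S. Mochizuki, *The étale theta function and its Frobenioid-theoretic manifestations*, Publ. RIMS **45** (2009)
[MochizukiEtTh2009], Def. 3.3 (iii) p. 299 (PDF p. 73), Def. 3.6 (i)/(ii) pp. 302–303 (PDF pp. 76–77), Prop. 3.4 (ii) p. 300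
(PDF p. 74: "`O_L^× = Ker(B₀ → Φ₀^gp)`" — the units ARE the constants' units, roots of unity included); S. Mochizuki, *The
geometry of Frobenioids I* [MochizukiFrdI2008], Def. 1.1 (ii) p. 19, Thm. 5.2 (i) p. 100.

abc-iut cell, layer L2; seat abc-iut-f-125 (gen 3), self-named row «TORSION-TF» (sequel of R228-NEXT, abc-iut-L2-lead gen 4).
CLASS (b) MODEL-CONSTRUCTION FILE (new path; nothing frozen is edited; abc-iut-L2-t3's `ToyTorsion.divisorMonoids` (p437160) and
abc-iut-w5-d164's `Toy.genuineTemperedFrobenioid` recipe (TemperedFrobenioidToyGenuine.lean) are consumed BY NAME).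

WHY.  Every tempered Frobenioid CONSTRUCTED in the tree so far for the §5 non-vacuity rows has TRIVIAL unit groups
(`B₀ = 𝔭^ℤ`, `B₀^Λ → (Φ₀^ℝ)^gp` injective: `Toy.realifiedGenuine_divΛ_injective`, whence `O^×(X) = 1` and `μ_N(X) = 1` —
abc-iut-f-125 `Discharge/Sec5CyclotomicCompatXRatFnNV.lean`, p442935).  Print's `B₀(Y) ⊇ L^×` has roots of unity MOVED by the
Galois action of the base.  abc-iut-L2-t3's Def. 3.3 (iii) datum `ToyTorsion.divisorMonoids` (`D₀ = SingleObj ℤ`, `Φ₀ = ℕ`,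
`B₀ = ℤ × (ℤ/2)²` with the generator of `Aut(⋆) = ℤ` SWAPPING the `(ℤ/2)²`-factors, `div₀ = pr₁`, `F₀ = B₀`) is the smallest
datum of that kind; this file runs it through abc-iut-L6-t12's Def. 3.6 (i) constructor `ofRlfZ` and abc-iut-w5-d164's Def. 3.6 (ii)
recipe, over the GENUINE monoid vocabulary `treeMonoidVocab` and the GENUINE category vocabulary `treeCatVocab`:

* `ToyTorsion.realifiedGenuine := ofRlfZ ToyTorsion.divisorMonoids _` (`Λ = ℤ`, `Φ₀^ℝ = ℕ^rlf`, `B₀^Λ = B₀ = ℤ × (ℤ/2)²`);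
* `ToyTorsion.genuineΦ` — `Φ := im(Φ₀^pf → Φ₀^rlf) ≅ ℚ_{≥0}` as a subfunctor in monoids over the identity base functor
  `SingleObj ℤ ⥤ SingleObj ℤ` (pull-backs act trivially on divisors: `pull_genuineΦ_eq`);
* **`ToyTorsion.genuineTemperedFrobenioid R S : TemperedFrobenioid realifiedGenuine (SingleObj ℤ) (treeCatVocab (SingleObj ℤ) R S)`**
  — `SingleObj ℤ` is connected and totally epimorphic (a groupoid); `Φ` group-saturated, perf-factorial, a divisorial monoid on
  `SingleObj ℤ` in the tree's sense (`IsMonoidOn`: every pull-back is the identity; objectwise monoprime ⇒ divisorial);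
  (a) `Φ^{bs-fld} = Φ` monoprime (every divisor is the divisor of a constant: `F₀ = B₀`, `div₀(𝔭^k, v) = 𝔭^k`); (b) `𝔭 = (1, 0) ∈ F₀`
  has divisor `ι(𝔭)/1 ≠ 1`;
* `ToyTorsion.ratFnTorsion v` — the rational functions `((0, v), 0) ∈ B(A) = B₀^Λ ×_{(Φ^{ℝ-log})^gp} Φ^gp`, `v ∈ (ℤ/2)²`, with TRIVIAL
  divisor, and `ToyTorsion.ratFnPull_ratFnTorsion`: pull-back along the generator SWAPS them — the rational-function monoid of
  this tempered Frobenioid has `2`-torsion moved by `Aut(⋆)` (its model Frobenioid therefore has `O^×(X) ⊇ (ℤ/2)²`, sequel file).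
HONEST LABEL: GENUINE vocabularies / realification / [FrdI] predicates; DEGENERATE geometry — one base object with automorphism
group `ℤ`, one prime, all functions constant, constants `ℤ × (ℤ/2)²` (so `μ_2 = (ℤ/2)²` is not cyclic).  A consistency /
non-vacuity object; NOT the tempered Frobenioid of a curve; nothing here bears on [IUTchIII] Cor. 3.12.  Typed ≠ proved.
-/

noncomputable section

namespace Literature.AnabelianGeometry.EtaleTheta

open CategoryTheory Opposite Literature.AlgebraicGeometry.Frobenioids

namespace ToyTorsion

open Example39NV

/-! ### The realified data of the torsion datum and the divisor monoid `Φ := im(Φ₀^pf → Φ₀^rlf)` -/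

/-- `Φ₀(Y) = ℕ` of the torsion datum is perf-factorial in the tree's sense (abc-iut-w5-d164's `Toy.isPerfFactorial_nat`; the
values of the constant functor `Φ₀` are `Multiplicative ℕ`).  [cite: MochizukiEtTh2009, Prop 3.4 p.300 (PDF p.74)] -/
theorem isPerfFactorial_Φ₀ (Y : (SingleObj (Multiplicative ℤ))ᵒᵖ) :
    IsPerfFactorial (Literature.AnabelianGeometry.EtaleTheta.ToyTorsion.divisorMonoids.Φ₀.obj Y) :=
  Toy.isPerfFactorial_nat

/-- `Φ₀(Y) = ℕ` of the torsion datum is monoprime (abc-iut-L1's `isMonoprime_multiplicative_nat`).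
[cite: MochizukiEtTh2009, Prop 3.4 p.300 (PDF p.74)] -/
theorem isMonoprime_Φ₀ (Y : (SingleObj (Multiplicative ℤ))ᵒᵖ) :
    IsMonoprime (Literature.AnabelianGeometry.EtaleTheta.ToyTorsion.divisorMonoids.Φ₀.obj Y) :=
  isMonoprime_multiplicative_nat

/-- **Def. 3.6 (i) realified data of the torsion datum** (abc-iut-L6-t12's constructor `ofRlfZ`): `Λ = ℤ`, `Φ₀^ℝ = ℕ^rlf`,
`B₀^Λ = B₀ = ℤ × (ℤ/2)²` with the swap action, `F₀^Λ = F₀ = B₀`, `ℝ·Φ₀^cnst` the genuine `ℝ`-span.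
[cite: MochizukiEtTh2009, Def 3.6 p.302 (PDF p.76)] -/
abbrev realifiedGenuine : RealifiedDivisorMonoids (D₀ := Base) treeMonoidVocab.{0} :=
  RealifiedDivisorMonoids.ofRlfZ divisorMonoids isPerfFactorial_Φ₀

/-- `Φ(Y) := im(Φ₀(Y)^pf → Φ₀(Y)^rlf) ⊆ Φ^{ℝ-log}(Y)` ("`Φ` … the perfection of the monoid `Φ₀`", read inside the realification).
[cite: MochizukiEtTh2009, Def 3.6 p.302 (PDF p.76)] -/
def pfImage (Y : Baseᵒᵖ) : Submonoid (realifiedGenuine.ΦR.obj Y) :=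
  MonoidHom.mrange (isPerfFactorial_Φ₀ Y).toRealification

/-- `Φ(Y)` is monoprime (`≅ ℕ^pf ≅ ℚ_{≥0}`). [cite: MochizukiEtTh2009, Def 3.6 p.303 (PDF p.77)] -/
theorem isMonoprime_pfImage (Y : Baseᵒᵖ) : IsMonoprime ↥(pfImage Y) :=
  isMonoprime_mrange_toRealification (isMonoprime_Φ₀ Y)

/-- `div₀` of the torsion datum: `div₀(𝔭^k, v) = 𝔭^k` (first projection, then `k ↦ 𝔭^k`).
[cite: MochizukiEtTh2009, Def 3.3 p.299 (PDF p.73)] -/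
theorem div₀_apply (Y : Baseᵒᵖ) (b : M) : divisorMonoids.div₀ Y b = Toy.divHom b.1 := rfl

/-- Every element of `(Φ^{ℝ-log})^gp(Y)` coming from `Φ(Y)` lies in `ℝ·Φ₀^cnst(Y)`: every `m ∈ Φ₀(Y) = ℕ` is the divisor
`div₀(𝔭^m, 0)` of a (constant) function (`F₀ = B₀`), so `Φ₀ ⊆ Φ₀^cnst ⊆ ℝ·Φ₀^cnst`, and `ℝ·Φ₀^cnst` is root-closed.
[cite: MochizukiEtTh2009, Def 3.6 p.303 (PDF p.77)] -/
theorem of_mem_cnstR_of_mem_pfImage (Y : Baseᵒᵖ) {x : realifiedGenuine.ΦR.obj Y} (hx : x ∈ pfImage Y) :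
    Algebra.GrothendieckGroup.of x ∈ realifiedGenuine.cnstR Y := by
  obtain ⟨a, rfl⟩ := hx
  obtain ⟨⟨m, n⟩, rfl⟩ := Perfection.mk_surjective a
  apply realifiedGenuine.mem_cnstR_of_pow_mem Y n.ne_zero
  rw [← map_pow, ← map_pow, Perfection.mk_pow_self]
  have key : EtaleTheta.gpMap (realifiedGenuine.toR Y) (realifiedGenuine.div₀ Y
      ((Multiplicative.ofAdd ((Multiplicative.toAdd (show Multiplicative ℕ from m) : ℕ) : ℤ), (1 : V)) : M)) ∈
      realifiedGenuine.cnstR Y :=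
    realifiedGenuine.cnst_le_cnstR Y _ (Submonoid.mem_top _)
  have hb : realifiedGenuine.div₀ Y
      ((Multiplicative.ofAdd ((Multiplicative.toAdd (show Multiplicative ℕ from m) : ℕ) : ℤ), (1 : V)) : M) =
      (Algebra.GrothendieckGroup.of m : Algebra.GrothendieckGroup (realifiedGenuine.Φ₀.obj Y)) :=
    Toy.divHom_ofAdd_toAdd (show Multiplicative ℕ from m)
  rw [hb, EtaleTheta.gpMap_of] at key
  exact key

/-- Hence `Φ(Y) ∩ (ℝ·Φ₀^cnst)(Y) = Φ(Y)` ("`Φ^{bs-fld} = Φ`": every divisor of the torsion datum is base-field-theoretic).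
[cite: MochizukiEtTh2009, Def 3.6 p.303 (PDF p.77)] -/
theorem pfImage_inf_cnstR_eq (Y : Baseᵒᵖ) :
    pfImage Y ⊓ (realifiedGenuine.cnstR Y).toSubmonoid.comap Algebra.GrothendieckGroup.of = pfImage Y :=
  inf_eq_left.mpr fun _ hx => of_mem_cnstR_of_mem_pfImage Y hx

/-- The generator `ι(𝔭) = ι(of 1) ∈ Φ(Y)` is not `1` (`ℕ^pf ↪ ℕ^rlf`, `ℕ` sharp). [cite: MochizukiEtTh2009, Def 3.6 p.303 (PDF p.77)] -/
theorem toRealification_of_ofAdd_one_ne_one (Y : Baseᵒᵖ) :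
    (isPerfFactorial_Φ₀ Y).toRealification
      (Perfection.of _ (Multiplicative.ofAdd (1 : ℕ))) ≠ 1 := by
  intro h
  have h1 := toRealification_injective (isPerfFactorial_Φ₀ Y)
    (h.trans (map_one _).symm)
  rw [Perfection.of_apply,
    Perfection.mk_eq_one_iff_of_isSharp (MonoprimeStructure.isSharp
      (isMonoprime_Φ₀ Y))] at h1
  have h2 : (Multiplicative.ofAdd (1 : ℕ) : Multiplicative ℕ) = 1 := h1
  exact one_ne_zero (ofAdd_eq_one.mp h2)

/-! ### Pull-backs act trivially on the divisors (`Φ₀` constant ⇒ `Φ₀^rlf(f) = id`) -/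

/-- `Φ₀^rlf(f) = id` for every arrow `f` of `(SingleObj ℤ)ᵒᵖ` (`Φ₀` is the constant functor `ℕ`; universal property of the
realification, abc-iut-L2-d2's `RlfUniversal.map_id`).  [cite: MochizukiFrdI2008, Prop. 5.3 p.103] -/
theorem rlfMap_Φ₀_eq_id {Y Y' : Baseᵒᵖ} (f : Y ⟶ Y') (x : realifiedGenuine.ΦR.obj Y) :
    (realifiedGenuine.ΦR.map f).hom x = cast (by obtain ⟨⟨⟩⟩ := Y; obtain ⟨⟨⟩⟩ := Y'; rfl) x := by
  obtain ⟨⟨⟩⟩ := Y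
  obtain ⟨⟨⟩⟩ := Y'
  have hid : rlfMap divisorMonoids.Φ₀ isPerfFactorial_Φ₀ f = MonoidHom.id _ :=
    RlfUniversal.map_id (isPerfFactorial_Φ₀ _) (isPerfFactorial_Φ₀ _).supports_rlf_R _
      (rlfMap_comp_toRealification divisorMonoids.Φ₀ isPerfFactorial_Φ₀ f)
  change rlfMap divisorMonoids.Φ₀ isPerfFactorial_Φ₀ f x = x
  rw [hid, MonoidHom.id_apply]

/-! ### The divisor monoid as a subfunctor and the tempered Frobenioid -/

/-- `Φ ⊆ Φ^{ℝ-log} := Φ₀^ℝ|_D` over the identity base functor: `A ↦ im(Φ₀^pf → Φ₀^rlf)`, stable under pull-back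
(`Φ₀(f)^rlf ∘ ι = ι ∘ Φ₀(f)^pf`).  [cite: MochizukiEtTh2009, Def 3.6 p.302 (PDF p.76)] -/
def genuineΦ : SubMonoidOn ((𝟭 Base).op ⋙ realifiedGenuine.ΦR) where
  carrier A := pfImage A
  map_mem := by
    rintro A B f _ ⟨a, rfl⟩
    refine ⟨Perfection.map (divisorMonoids.Φ₀.map f).hom a, ?_⟩
    have h := DFunLike.congr_fun (rlfMap_comp_toRealification divisorMonoids.Φ₀ isPerfFactorial_Φ₀ f) a
    simp only [MonoidHom.comp_apply] at h
    exact h.symm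

/-- `Φ(A)` is `pfImage A`. [cite: MochizukiEtTh2009, Def 3.6 p.302 (PDF p.76)] -/
@[simp] theorem genuineΦ_carrier (A : Baseᵒᵖ) : genuineΦ.carrier A = pfImage A := rfl

/-- Pull-back along any arrow is the identity on `Φ` (one prime, trivial action on divisors).
[cite: MochizukiFrdI2008, Def. 1.1 (ii) p.19] -/
theorem pull_genuineΦ_eq {A B : Base} (α : B ⟶ A) (x : genuineΦ.toFunctor.obj (op A)) : pull genuineΦ.toFunctor α x = x := by
  obtain ⟨⟩ := A
  obtain ⟨⟩ := B
  apply Subtype.ext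
  change (realifiedGenuine.ΦR.map ((𝟭 Base).map α).op).hom x.1 = x.1
  rw [rlfMap_Φ₀_eq_id]
  rfl

/-- Hence `Φ` is a monoid on `SingleObj ℤ` in the sense of [FrdI] Def. 1.1 (ii) (pull-backs characteristically injective,
bijective along FSM-morphisms — they are identities).  [cite: MochizukiFrdI2008, Def. 1.1 (ii) p.19] -/
theorem isMonoidOn_genuineΦ : IsMonoidOn genuineΦ.toFunctor where
  isCharInjective {A B} α := by
    have hid : pull genuineΦ.toFunctor α = MonoidHom.id _ := MonoidHom.ext fun x => pull_genuineΦ_eq α x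
    refine ⟨fun x y h => by rwa [hid] at h, fun x y hxy => ?_⟩
    obtain ⟨a', rfl⟩ := Associates.mk_surjective x
    obtain ⟨b', rfl⟩ := Associates.mk_surjective y
    rw [associatesMap_mk, associatesMap_mk, hid] at hxy
    exact hxy
  bijective_of_isFSM {A B} α _ := by
    have hid : pull genuineΦ.toFunctor α = MonoidHom.id _ := MonoidHom.ext fun x => pull_genuineΦ_eq α x
    rw [hid]
    exact Function.bijective_id

variable (R S : (Baseᵒᵖ ⥤ CommMonCat.{0}) → Prop)

/-- `SingleObj ℤ` is connected (one object). [cite: MochizukiEtTh2009, Def 3.6 p.302 (PDF p.76)] -/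
theorem isConnected_base : IsConnected Base := zigzag_isConnected fun j₁ j₂ => by rw [Subsingleton.elim j₁ j₂]

/-- `SingleObj ℤ` is totally epimorphic (a groupoid: every arrow is invertible). [cite: MochizukiFrdI2008, §0 p.14] -/
theorem isTotallyEpimorphic_base : IsTotallyEpimorphic Base :=
  ⟨fun f => ⟨fun g h w => by
    rw [SingleObj.comp_as_mul, SingleObj.comp_as_mul] at w
    exact mul_right_cancel (G := Multiplicative ℤ) w⟩⟩

/-- **Def. 3.6 (ii) data over the GENUINE vocabularies for the torsion datum** — the tempered Frobenioid structure on
`(D := SingleObj ℤ → D₀ = SingleObj ℤ, Φ := im(Φ₀^pf → Φ₀^rlf))` over `ofRlfZ ToyTorsion.divisorMonoids`: `D` connected and totally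
epimorphic; `Φ` group-saturated in `Φ^{ℝ-log}`, perf-factorial, a divisorial monoid on `D` in the TREE's sense; (a) `Φ^{bs-fld} = Φ`
monoprime; (b) `𝔭 = (1, 0) ∈ F₀` has divisor `ι(𝔭)/1 ≠ 1`.  `R`, `S` = the [FrdI] Def. 4.5 predicates, parameters as in `treeCatVocab`.
Its rational-function monoid `B = B₀^Λ ×_{(Φ^{ℝ-log})^gp} Φ^gp` carries the `2`-torsion `(0, v)`, `v ∈ (ℤ/2)²`, SWAPPED by the generator
of `Aut(⋆)`.  [cite: MochizukiEtTh2009, Def 3.6 p.303 (PDF p.77)] -/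
def genuineTemperedFrobenioid : TemperedFrobenioid realifiedGenuine Base (treeCatVocab Base R S) where
  isConnected := isConnected_base
  isTotallyEpimorphic := isTotallyEpimorphic_base
  base := 𝟭 _
  Φ := genuineΦ
  isGroupSaturated A := isGroupSaturated_mrange_toRealification (isPerfFactorial_Φ₀ A)
  isPerfFactorial A :=
    isPerfFactorial_mrange_toRealification (isMonoprime_Φ₀ A)
  isDivisorialOn := by
    rw [treeCatVocab_isDivisorialOn]
    exact ⟨isMonoidOn_genuineΦ, fun A => MonoprimeStructure.isDivisorial (isMonoprime_pfImage (op A))⟩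
  isMonoprime_bsFld A :=
    IsMonoprime.of_mulEquiv (MulEquiv.submonoidCongr (pfImage_inf_cnstR_eq A).symm) (isMonoprime_pfImage A)
  exists_FΛ_div_ne A := by
    refine ⟨((Multiplicative.ofAdd (1 : ℤ), (1 : V)) : M), Submonoid.mem_top _,
      (isPerfFactorial_Φ₀ A).toRealification
        (Perfection.of _ (Multiplicative.ofAdd (1 : ℕ))),
      ⟨_, rfl⟩, 1, one_mem _, toRealification_of_ofAdd_one_ne_one A, ?_⟩
    show EtaleTheta.gpMap (realifiedGenuine.toR A) (Toy.divHom (Multiplicative.ofAdd (1 : ℤ))) = _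
    simp only [map_one, div_one]
    exact (congrArg (EtaleTheta.gpMap (realifiedGenuine.toR A)) Toy.divHom_ofAdd_one).trans
      (EtaleTheta.gpMap_of _ _)

/-- `Φ` of the torsion tempered Frobenioid is `pfImage`. [cite: MochizukiEtTh2009, Def 3.6 p.303 (PDF p.77)] -/
@[simp] theorem genuineTemperedFrobenioid_Φ_carrier (A : Baseᵒᵖ) :
    (genuineTemperedFrobenioid R S).Φ.carrier A = pfImage A := rfl

/-- The base functor is the identity of `SingleObj ℤ`. [cite: MochizukiEtTh2009, Def 3.6 p.303 (PDF p.77)] -/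
@[simp] theorem genuineTemperedFrobenioid_base : (genuineTemperedFrobenioid R S).base = 𝟭 _ := rfl

/-- The monoid type is `ℤ`. [cite: MochizukiEtTh2009, Def 3.6 p.302 (PDF p.76)] -/
theorem genuineTemperedFrobenioid_monoidType : (genuineTemperedFrobenioid R S).monoidType = MonoidType.Z := rfl

/-- **Non-vacuity of `TemperedFrobenioid _ (SingleObj ℤ) (treeCatVocab …)`** over a base object WITH automorphisms acting
non-trivially on `B₀^Λ`.  [cite: MochizukiEtTh2009, Def 3.6 p.303 (PDF p.77)] -/
theorem nonempty_temperedFrobenioid_singleObj :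
    Nonempty (TemperedFrobenioid realifiedGenuine Base (treeCatVocab Base R S)) := ⟨genuineTemperedFrobenioid R S⟩

/-! ### The torsion rational functions `((0, v), 0) ∈ B(A)` and the swap -/

/-- `div₀^Λ(𝔭^k, v)` depends only on `k`: `B₀^Λ → (Φ₀^ℝ)^gp` kills the `(ℤ/2)²`-part (which is what makes `O^×` non-trivial).
[cite: MochizukiEtTh2009, Prop 3.4 p.300 (PDF p.74)] -/
theorem divΛ_apply (Y : Baseᵒᵖ) (b : M) :
    realifiedGenuine.divΛ Y b = EtaleTheta.gpMap (realifiedGenuine.toR Y) (Toy.divHom b.1) := rfl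

/-- **The rational function `((0, v), 0) ∈ B(A) = B₀^Λ(Y_A) ×_{(Φ^{ℝ-log})^gp} Φ(A)^gp`** of the torsion tempered Frobenioid,
`v ∈ (ℤ/2)²`: its divisor is trivial on both sides.  [cite: MochizukiEtTh2009, Def 3.6 p.303 (PDF p.77)] -/
def ratFnTorsion (A : Baseᵒᵖ) (v : V) : (genuineTemperedFrobenioid R S).ratFn A :=
  ⟨(((1 : Multiplicative ℤ), v), 1), by
    change realifiedGenuine.divΛ _ ((1 : Multiplicative ℤ), v) = (genuineTemperedFrobenioid R S).ΦgpToRlog A 1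
    rw [map_one, divΛ_apply]
    change EtaleTheta.gpMap _ (Toy.divHom 1) = 1
    rw [map_one, map_one]⟩

/-- Components of `ratFnTorsion`. [cite: MochizukiEtTh2009, Def 3.6 p.303 (PDF p.77)] -/
@[simp] theorem coe_ratFnTorsion (A : Baseᵒᵖ) (v : V) :
    (ratFnTorsion R S A v).1 = (((1 : Multiplicative ℤ), v), 1) := rfl

/-- `ratFnTorsion` is multiplicative in `v`; in particular `ratFnTorsion v * ratFnTorsion v = 1` as `v² = 1`.
[cite: MochizukiEtTh2009, Def 3.6 p.303 (PDF p.77)] -/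
theorem ratFnTorsion_mul (A : Baseᵒᵖ) (v w : V) :
    ratFnTorsion R S A v * ratFnTorsion R S A w = ratFnTorsion R S A (v * w) :=
  Subtype.ext (Prod.ext (Prod.ext (mul_one _) rfl) (mul_one _))

/-- `ratFnTorsion v ≠ 1` for `v ≠ 0`: **`B(A)` has non-trivial `2`-torsion with trivial divisor.**
[cite: MochizukiEtTh2009, Prop 3.4 p.300 (PDF p.74)] -/
theorem ratFnTorsion_ne_one (A : Baseᵒᵖ) {v : V} (hv : v ≠ 1) : ratFnTorsion R S A v ≠ 1 := fun h =>
  hv (congrArg (fun p : (genuineTemperedFrobenioid R S).ratFn A => p.1.1.2) h)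

/-- **Pull-back of rational functions along an arrow `n` of the base acts on the torsion through the swap action**
(`B₀^Λ(n) = swapE^n`; the `Φ^gp`-component `1` is fixed).  [cite: MochizukiEtTh2009, Def 3.6 p.303 (PDF p.77)] -/
theorem ratFnPull_ratFnTorsion {A A' : Baseᵒᵖ} (f : A ⟶ A') (v : V) :
    (genuineTemperedFrobenioid R S).ratFnPull f (ratFnTorsion R S A v) = ratFnTorsion R S A' (act f.unop ((1 : Multiplicative ℤ), v)).2 := by
  apply Subtype.ext
  rw [TemperedFrobenioid.coe_ratFnPull, coe_ratFnTorsion, coe_ratFnTorsion, map_one]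
  refine Prod.ext (Prod.ext ?_ rfl) rfl
  change (act f.unop ((1 : Multiplicative ℤ), v)).1 = 1
  rw [act_fst]

/-- In particular along the generator `γ = 1 ∈ ℤ` the torsion rational function `((0,(a,b)),0)` becomes `((0,(b,a)),0)`.
[cite: MochizukiEtTh2009, Def 3.6 p.303 (PDF p.77)] -/
theorem ratFnPull_gen_ratFnTorsion {A A' : Baseᵒᵖ} (f : A ⟶ A') (hf : f.unop = Multiplicative.ofAdd (1 : ℤ)) (v : V) :
    (genuineTemperedFrobenioid R S).ratFnPull f (ratFnTorsion R S A v) = ratFnTorsion R S A' (v.2, v.1) := by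
  rw [ratFnPull_ratFnTorsion, hf, act_apply, toAdd_ofAdd, zpow_one, swapE_apply]

end ToyTorsion

end Literature.AnabelianGeometry.EtaleTheta

end
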